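import Mathlib
import Literature.Combinatorics.Optimization.HighMinEntropyDecomposition
import Literature.Combinatorics.Optimization.MaxThreeSatThreeXorGapsUnconditional
import Literature.Combinatorics.Optimization.LpGapFromSheraliAdamsGap
import Literature.Combinatorics.Optimization.MaxCutLpLowerBound
import Literature.Combinatorics.Optimization.MaxCutSheraliAdamsGap
import HarnessLib

/-!
# Kothari–Meka–Raghavendra 2017: the LP lower bounds for Max-CSPs, now unconditional

Sink module (composition only).  `HighMinEntropyDecomposition.lean` proves KMR Theorem 1.10
(`KothariMekaRaghavendra2017_thm110_holds`).  Feeding it to the tree's reductions "from Thm 1.10"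
discharges the named facts

* `KothariMekaRaghavendra2017_cor15_threeSat` (KMR Cor. 1.5, MAX-3SAT: no LP relaxation of size
  `< 2^{c₁ n^{1/H}}` has integrality gap `< 8/7 − ε`) — `KothariMekaRaghavendra2017_cor15_threeSat_holds`;
* `KothariMekaRaghavendra2017_cor15_threeXor` (KMR Cor. 1.5, MAX-3XOR, gap `< 2 − ε`) —
  `KothariMekaRaghavendra2017_cor15_threeXor_holds`;

* `KothariMekaRaghavendra2017_cor15_maxCut` (KMR Cor. 1.5, MAX-CUT, gap `< 2 − ε`) —
  `KothariMekaRaghavendra2017_cor15_maxCut_holds` (v2: the Charikar–Makarychev–Makarychev Sherali–Adams gap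
  `CharikarMakarychevMakarychev2009_maxCutSA` is now a theorem of the tree, `MaxCutSheraliAdamsGap.lean`,
  littype-FN2-1 g20);

and records the UNCONDITIONAL forms of: KMR Thm 1.2 in the form its printed proof delivers
(`KothariMekaRaghavendra2017_thm12_proved`, conclusion for `(c − 1/n, s)`), the general transfer
"linear-round Sherali–Adams gap ⇒ sub-exponential LP lower bound" (`KothariMekaRaghavendra2017_lpGap_of_SAgap`),
KMR Thm 1.4 / Cor. 1.5 for Max-`k`-XOR, Max-`k`-SAT and every parity-implied predicate, `k ≥ 3`
(`KothariMekaRaghavendra2017_cor15_kXor`, `_kSat`, `_maxKSat`, `_parityImplied`), and KMR Cor. 1.5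
for MAX-CUT conditional only on the Charikar–Makarychev–Makarychev Sherali–Adams gap
(`KothariMekaRaghavendra2017_cor15_maxCut_of_CMM`).

No definitions, no named facts.

## References
* P. K. Kothari, R. Meka, P. Raghavendra, *Approximating rectangles by juntas and weakly-exponential lower
  bounds for LP relaxations of CSPs*, STOC 2017 / SIAM J. Comput. 51 (2022), arXiv:1610.02704 —
  Thm 1.2, Thm 1.4, Cor. 1.5 (p. 3–4), Thm 1.10 (p. 5), §7 (p. 20–21) [KothariMekaRaghavendra2017].
-/

noncomputable section

open Finset

namespace Literature.Combinatorics.Optimization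

/-- **KMR Corollary 1.5 (MAX-3SAT) — PROVED** (discharging `KothariMekaRaghavendra2017_cor15_threeSat`):
for a universal `H ≥ 1` and every `ε > 0` there are `c₁ > 0`, `n₀` with: for `n ≥ n₀` no LP relaxation
of MAX-3SAT on `n` variables of size `< 2^{c₁ n^{1/H}}` has integrality gap `< 8/7 − ε`.
[cite: KothariMekaRaghavendra2017, Cor. 1.5 (p. 4) with its proof (§7, p. 21)] -/
theorem KothariMekaRaghavendra2017_cor15_threeSat_holds : KothariMekaRaghavendra2017_cor15_threeSat :=
  KothariMekaRaghavendra2017_cor15_threeSat_of_thm110' KothariMekaRaghavendra2017_thm110_holds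

/-- **KMR Corollary 1.5 (MAX-3XOR) — PROVED** (discharging `KothariMekaRaghavendra2017_cor15_threeXor`):
for a universal `H ≥ 1` and every `ε > 0` there are `c₂ > 0`, `n₀` with: for `n ≥ n₀` no LP relaxation
of MAX-3XOR on `n` variables of size `< 2^{c₂ n^{1/H}}` has integrality gap `< 2 − ε`.
[cite: KothariMekaRaghavendra2017, Cor. 1.5 (p. 4) with its proof (§7, p. 21)] -/
theorem KothariMekaRaghavendra2017_cor15_threeXor_holds : KothariMekaRaghavendra2017_cor15_threeXor :=
  KothariMekaRaghavendra2017_cor15_threeXor_of_thm110' KothariMekaRaghavendra2017_thm110_holds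

/-- **KMR Corollary 1.5 (MAX-CUT), conditional only on the Charikar–Makarychev–Makarychev
Sherali–Adams gap** (`CharikarMakarychevMakarychev2009_maxCutSA`, a named fact of the tree).
[cite: KothariMekaRaghavendra2017, Cor. 1.5 (p. 4) with its proof (§7, p. 20–21)] -/
theorem KothariMekaRaghavendra2017_cor15_maxCut_of_CMM (hCMM : CharikarMakarychevMakarychev2009_maxCutSA) :
    KothariMekaRaghavendra2017_cor15_maxCut :=
  KothariMekaRaghavendra2017_cor15_maxCut_of_thm110 KothariMekaRaghavendra2017_thm110_holds hCMM

/-- **KMR Corollary 1.5 (MAX-CUT) — PROVED** (discharging `KothariMekaRaghavendra2017_cor15_maxCut`): for a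
universal `H ≥ 1` and every `ε > 0` there are `c₃ > 0`, `n₀` with: for `n ≥ n₀` no LP relaxation of MAX-CUT on `n`
vertices of size `< 2^{c₃ n^{1/H}}` has integrality gap `< 2 − ε` — KMR Thm 1.10 (`KothariMekaRaghavendra2017_thm110_holds`)
and the Charikar–Makarychev–Makarychev Sherali–Adams gap, now a theorem
(`CharikarMakarychevMakarychev2009_maxCutSA_holds`, `MaxCutSheraliAdamsGap.lean`).
[cite: KothariMekaRaghavendra2017, Cor. 1.5 (p. 4) with its proof (§7, p. 20–21)]
[cite: CharikarMakarychevMakarychev2009, Thm 5.3] -/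
theorem KothariMekaRaghavendra2017_cor15_maxCut_holds : KothariMekaRaghavendra2017_cor15_maxCut :=
  KothariMekaRaghavendra2017_cor15_maxCut_of_CMM CharikarMakarychevMakarychev2009_maxCutSA_holds

/-- **KMR Theorem 1.2 in the form its printed proof delivers — PROVED:** there are `0 < h < H` and `n₀`
such that for every `k`-ary Max-CSP `𝒫`, all `c ≤ 1`, `s`, every `f` and `n ≥ n₀` with `1/n < c − s`
and `f(n) ≥ 16k`: if degree-`f(n)` Sherali–Adams fails to `(c,s)`-approximate Max-`𝒫_n`, then no LP
relaxation of Max-`𝒫_{n^H}` of size `≤ n^{h f(n)}` achieves a `(c − 1/n, s)`-approximation.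
[cite: KothariMekaRaghavendra2017, Thm 1.2 (p. 3) with its proof (§7, p. 20)] -/
theorem KothariMekaRaghavendra2017_thm12_proved :
    ∃ (h : ℝ) (H n₀ : ℕ), 0 < h ∧ h < H ∧
      ∀ (k : ℕ) (P : Set ((Fin k → Bool) → Bool)) (c s : ℝ), c ≤ 1 →
      ∀ (f : ℕ → ℕ) (n : ℕ), n₀ ≤ n → 1 / (n : ℝ) < c - s → 16 * k ≤ f n →
        ¬ SAAchieves (n := n) P (f n) c s →
        ∀ R : ℕ, (R : ℝ) ≤ (n : ℝ) ^ (h * f n) →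
          ∀ L : LPRelaxation k (n ^ H) P R, ¬ L.Achieves (c - 1 / n) s :=
  KothariMekaRaghavendra2017_thm12_of_thm110 KothariMekaRaghavendra2017_thm110_holds

/-- **KMR Cor. 1.5 for an arbitrary Max-CSP — PROVED:** a linear-round Sherali–Adams gap at `(1 − ε,
s₀ + ε)` for every `ε` gives, for some `H ≥ 1` and every `ε > 0`, constants `c₁ > 0`, `N₀` such that no
LP relaxation of Max-`𝒫_N` (`N ≥ N₀`) of size `< 2^{c₁ N^{1/H}}` has integrality gap `< 1/s₀ − ε`.
[cite: KothariMekaRaghavendra2017, Cor. 1.5 and its proof (§7, p. 21), Thm 1.2, Thm 1.4] -/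
theorem KothariMekaRaghavendra2017_lpGap_of_SAgap {k : ℕ} (P : Set ((Fin k → Bool) → Bool))
    {s₀ : ℝ} (hs₀ : 0 < s₀) (hs₁ : s₀ < 1)
    (hSAgap : ∀ ε : ℝ, 0 < ε → ∃ cε : ℝ, 0 < cε ∧ ∃ n₀ : ℕ, ∀ n : ℕ, n₀ ≤ n →
      ¬ SAAchieves (n := n) P ⌊cε * n⌋₊ (1 - ε) (s₀ + ε)) :
    ∃ H : ℝ, 1 ≤ H ∧ ∀ ε : ℝ, 0 < ε → ∃ c₁ : ℝ, 0 < c₁ ∧ ∃ N₀ : ℕ, ∀ N : ℕ, N₀ ≤ N →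
      ∀ R : ℕ, (R : ℝ) < (2 : ℝ) ^ (c₁ * (N : ℝ) ^ (1 / H)) →
        ∀ L : LPRelaxation k N P R, ¬ L.GapLT (1 / s₀ - ε) :=
  KothariMekaRaghavendra2017_lpGap_of_SAgap_of_thm110 KothariMekaRaghavendra2017_thm110_holds P hs₀ hs₁ hSAgap

/-- **KMR Thm 1.4 / Cor. 1.5 for Max-`k`-XOR, every `k ≥ 3` — PROVED:** no LP relaxation of size
`< 2^{c₂ n^{1/H}}` has integrality gap `< 2 − ε`. [cite: KothariMekaRaghavendra2017, Thm 1.4 and Cor. 1.5 (p. 4), proof p. 21] -/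
theorem KothariMekaRaghavendra2017_cor15_kXor {k : ℕ} (hk : 3 ≤ k) :
    ∃ H : ℝ, 1 ≤ H ∧ ∀ ε : ℝ, 0 < ε → ∃ c₂ : ℝ, 0 < c₂ ∧ ∃ n₀ : ℕ, ∀ n : ℕ, n₀ ≤ n →
      ∀ R : ℕ, (R : ℝ) < (2 : ℝ) ^ (c₂ * (n : ℝ) ^ (1 / H)) →
        ∀ L : LPRelaxation k n (literalClosure (xorK k)) R, ¬ L.GapLT (2 - ε) :=
  KothariMekaRaghavendra2017_cor15_kXor_of_thm110 KothariMekaRaghavendra2017_thm110_holds hk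

/-- **KMR Cor. 1.5-type LP lower bound for every parity-implied, not identically true `k`-ary predicate,
`k ≥ 3` — PROVED:** gap `< 2^k/|P⁻¹(1)| − ε` is impossible below size `2^{c₂ n^{1/H}}`.
[cite: KothariMekaRaghavendra2017, Thm 1.4 and Cor. 1.5 (p. 4), proof p. 21] -/
theorem KothariMekaRaghavendra2017_cor15_parityImplied {k : ℕ} (hk : 3 ≤ k) {P : (Fin k → Bool) → Bool}
    (hP : ∀ y, xorK k y = true → P y = true) (hPne : ∃ y, P y = false) :
    ∃ H : ℝ, 1 ≤ H ∧ ∀ ε : ℝ, 0 < ε → ∃ c₂ : ℝ, 0 < c₂ ∧ ∃ n₀ : ℕ, ∀ n : ℕ, n₀ ≤ n →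
      ∀ R : ℕ, (R : ℝ) < (2 : ℝ) ^ (c₂ * (n : ℝ) ^ (1 / H)) →
        ∀ L : LPRelaxation k n (literalClosure P) R,
          ¬ L.GapLT ((2 : ℝ) ^ k / ((univ : Finset (Fin k → Bool)).filter fun y => P y = true).card - ε) :=
  KothariMekaRaghavendra2017_cor15_parityImplied_of_thm110 KothariMekaRaghavendra2017_thm110_holds hk hP hPne

/-- **KMR Thm 1.4 / Cor. 1.5 for Max-`k`-SAT (= CSP(`or_k`)), every `k ≥ 3` — PROVED:** no LP
relaxation of size `< 2^{c₂ n^{1/H}}` has integrality gap `< 2^k/(2^k − 1) − ε`.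
[cite: KothariMekaRaghavendra2017, Thm 1.4 and Cor. 1.5 (p. 4), proof p. 21] -/
theorem KothariMekaRaghavendra2017_cor15_kSat {k : ℕ} (hk : 3 ≤ k) :
    ∃ H : ℝ, 1 ≤ H ∧ ∀ ε : ℝ, 0 < ε → ∃ c₂ : ℝ, 0 < c₂ ∧ ∃ n₀ : ℕ, ∀ n : ℕ, n₀ ≤ n →
      ∀ R : ℕ, (R : ℝ) < (2 : ℝ) ^ (c₂ * (n : ℝ) ^ (1 / H)) →
        ∀ L : LPRelaxation k n (literalClosure (orK k)) R,
          ¬ L.GapLT ((2 : ℝ) ^ k / (2 ^ k - 1) - ε) :=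
  KothariMekaRaghavendra2017_cor15_kSat_of_thm110 KothariMekaRaghavendra2017_thm110_holds hk

/-- **KMR Thm 1.4 / Cor. 1.5 for Max-`k`-SAT as `maxKSatPreds k`, every `k ≥ 3` — PROVED.**
[cite: KothariMekaRaghavendra2017, Thm 1.4 and Cor. 1.5 (p. 4), proof p. 21] -/
theorem KothariMekaRaghavendra2017_cor15_maxKSat {k : ℕ} (hk : 3 ≤ k) :
    ∃ H : ℝ, 1 ≤ H ∧ ∀ ε : ℝ, 0 < ε → ∃ c₂ : ℝ, 0 < c₂ ∧ ∃ n₀ : ℕ, ∀ n : ℕ, n₀ ≤ n →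
      ∀ R : ℕ, (R : ℝ) < (2 : ℝ) ^ (c₂ * (n : ℝ) ^ (1 / H)) →
        ∀ L : LPRelaxation k n (maxKSatPreds k) R,
          ¬ L.GapLT ((2 : ℝ) ^ k / (2 ^ k - 1) - ε) :=
  KothariMekaRaghavendra2017_cor15_maxKSat_of_thm110 KothariMekaRaghavendra2017_thm110_holds hk

end Literature.Combinatorics.Optimization

end
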